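import Summits.FinalStateConjecture.FinalStateConjecture.Theorems.PhotonSphereChannelsBlindnessWaveLeibniz

/-!
# Route PhotonSphereChannels · BlindnessInsidePhotonSphere — the 1+1 wave equation with a
# potential, II: regularity of the solution of the characteristic integral equations

Support file (pure analysis, everything proved) for item stmt-FinalStateConjecture-10049.
For continuous `Ψ, Q : ℝ² → ℝ` solving

  `Ψ(a, b) = A(a) − ∫_b^a Q(a, s) ds`,   `Q(a, b) = A'(b)/2 + ∫_b^a c(s, b) Ψ(s, b) ds`

with `A ∈ C²` and `c ∈ C¹` (the Volterra form of the characteristic Cauchy problem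
`Ψ_ab = c Ψ`, `Ψ(a,a) = A(a)`, `Ψ_a = Ψ_b = A'/2` on the diagonal, solved in the companion file
`PhotonSphereChannelsBlindnessWavePicard`), this file proves by the classical bootstrap
(Courant–Hilbert II, Ch. V §5) that `Ψ ∈ C²(ℝ²)` with
`∂_b Ψ = Q`, `∂_a Ψ = P := A'(a) − Q(a,a) − ∫_b^a c(a,s)Ψ(a,s) ds`, `P, Q ∈ C¹`,
`∂_b P = ∂_a Q = c Ψ` (`contDiff_two_psi`, `hasFDerivAt_psi`, `fderiv_P_snd`, `fderiv_Q_fst`).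
Tools: the Leibniz rules of `PhotonSphereChannelsBlindnessWaveLeibniz` and the criterion
"`C^{n+1}` from `Cⁿ` partial derivatives" (`Literature.Analysis.Calculus.contDiffOn_succ_of_partial`).
No definitions are introduced.
-/

noncomputable section

open Set Filter MeasureTheory intervalIntegral Topology Function
open scoped Interval

namespace Summit.FinalStateConjecture.FinalStateConjecture.Theorems.Blindness

/-! ### The bootstrap -/

section Bootstrap

variable {c Ψ Q : ℝ → ℝ → ℝ} {A : ℝ → ℝ}

/-- `∂_b Ψ = Q` (fundamental theorem of calculus in the first equation). -/
theorem hasDerivAt_psi_snd (hQc : Continuous (uncurry Q))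
    (hΨ : ∀ a b, Ψ a b = A a - ∫ s in b..a, Q a s) (a b : ℝ) :
    HasDerivAt (fun b => Ψ a b) (Q a b) b := by
  have hQa : Continuous (Q a) := hQc.comp (Continuous.prodMk_right a)
  have h := integral_hasDerivAt_left (hQa.intervalIntegrable b a)
    (hQa.stronglyMeasurableAtFilter _ _) hQa.continuousAt
  have h' : HasDerivAt (fun b => Ψ a b) (-(-Q a b)) b :=
    (h.const_sub (A a)).congr_of_eventuallyEq (Eventually.of_forall fun x => by simp [hΨ a x])
  exact h'.congr_deriv (neg_neg _)

/-- `∂_a Q = c Ψ` (fundamental theorem of calculus in the second equation). -/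
theorem hasDerivAt_Q_fst (hc : Continuous (uncurry c)) (hΨc : Continuous (uncurry Ψ))
    (hQ : ∀ a b, Q a b = deriv A b / 2 + ∫ s in b..a, c s b * Ψ s b) (a b : ℝ) :
    HasDerivAt (fun a => Q a b) (c a b * Ψ a b) a := by
  have hkb : Continuous fun s => c s b * Ψ s b :=
    (hc.comp (continuous_id.prodMk continuous_const)).mul
      (hΨc.comp (continuous_id.prodMk continuous_const))
  have h := integral_hasDerivAt_right (hkb.intervalIntegrable b a)
    (hkb.stronglyMeasurableAtFilter _ _) hkb.continuousAt
  exact (h.const_add (deriv A b / 2)).congr_of_eventuallyEq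
    (Eventually.of_forall fun x => by simp [hQ x b])

/-- `∂_a Ψ = P`, `P(a,b) = A'(a) − Q(a,a) − ∫_b^a c(a,s) Ψ(a,s) ds` (Leibniz rule in the first
equation, using `∂_a Q = cΨ`). -/
theorem hasDerivAt_psi_fst (hc : Continuous (uncurry c)) (hA : ContDiff ℝ 2 A)
    (hΨc : Continuous (uncurry Ψ)) (hQc : Continuous (uncurry Q))
    (hΨ : ∀ a b, Ψ a b = A a - ∫ s in b..a, Q a s)
    (hQ : ∀ a b, Q a b = deriv A b / 2 + ∫ s in b..a, c s b * Ψ s b) (a b : ℝ) :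
    HasDerivAt (fun a => Ψ a b) (deriv A a - Q a a - ∫ s in b..a, c a s * Ψ a s) a := by
  have hL := hasDerivAt_integral_param_upper (k := Q) (k₁ := fun a s => c a s * Ψ a s) hQc
    (hc.mul hΨc) (fun a s => hasDerivAt_Q_fst hc hΨc hQ a s) b a
  have hAd : HasDerivAt A (deriv A a) a :=
    ((hA.differentiable (by norm_num)) a).hasDerivAt
  have h : HasDerivAt (fun a => Ψ a b) (deriv A a - (Q a a + ∫ s in b..a, c a s * Ψ a s)) a :=
    (hAd.sub hL).congr_of_eventuallyEq (Eventually.of_forall fun x => by simp [hΨ x b])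
  exact h.congr_deriv (by ring)

/-- The slice derivative of `c` in the second variable. -/
theorem hasDerivAt_c_snd (hc : ContDiff ℝ 1 (uncurry c)) (s b : ℝ) :
    HasDerivAt (fun b => c s b) (fderiv ℝ (uncurry c) (s, b) (0, 1)) b :=
  hasDerivAt_snd_of_hasFDerivAt (p := (s, b)) ((hc.differentiable one_ne_zero) (s, b)).hasFDerivAt

/-- The slice derivative of `c` in the first variable. -/
theorem hasDerivAt_c_fst (hc : ContDiff ℝ 1 (uncurry c)) (a s : ℝ) :
    HasDerivAt (fun a => c a s) (fderiv ℝ (uncurry c) (a, s) (1, 0)) a :=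
  hasDerivAt_fst_of_hasFDerivAt (p := (a, s)) ((hc.differentiable one_ne_zero) (a, s)).hasFDerivAt

/-- `A ∈ C²` : `A'` is `C¹` and `(A')' ` exists. -/
theorem contDiff_one_deriv_of_two (hA : ContDiff ℝ 2 A) : ContDiff ℝ 1 (deriv A) := by
  have h2 : ContDiff ℝ (1 + 1) A := by simpa [one_add_one_eq_two] using hA
  exact (contDiff_succ_iff_deriv.1 h2).2.2

/-- `∂_b Q = R`,
`R(a,b) = A''(b)/2 − c(b,b)Ψ(b,b) + ∫_b^a (∂_b c(s,b) Ψ(s,b) + c(s,b) Q(s,b)) ds`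
(Leibniz rule in the second equation, using `∂_b Ψ = Q`). -/
theorem hasDerivAt_Q_snd (hc : ContDiff ℝ 1 (uncurry c)) (hA : ContDiff ℝ 2 A)
    (hΨc : Continuous (uncurry Ψ)) (hQc : Continuous (uncurry Q))
    (hΨ : ∀ a b, Ψ a b = A a - ∫ s in b..a, Q a s)
    (hQ : ∀ a b, Q a b = deriv A b / 2 + ∫ s in b..a, c s b * Ψ s b) (a b : ℝ) :
    HasDerivAt (fun b => Q a b) (deriv (deriv A) b / 2 - c b b * Ψ b b +
      ∫ s in b..a, (fderiv ℝ (uncurry c) (s, b) (0, 1) * Ψ s b + c s b * Q s b)) b := by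
  have hcc : Continuous (uncurry c) := hc.continuous
  have hc₂ : Continuous fun p : ℝ × ℝ => fderiv ℝ (uncurry c) (p.1, p.2) (0, 1) :=
    (hc.continuous_fderiv one_ne_zero).clm_apply continuous_const
  have hL := hasDerivAt_integral_param_lower (k := fun s b => c s b * Ψ s b)
    (k₂ := fun s b => fderiv ℝ (uncurry c) (s, b) (0, 1) * Ψ s b + c s b * Q s b)
    (hcc.mul hΨc) ((hc₂.mul hΨc).add (hcc.mul hQc))
    (fun s b => ((hasDerivAt_c_snd hc s b).mul (hasDerivAt_psi_snd hQc hΨ s b)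
      |>.congr_of_eventuallyEq (Eventually.of_forall fun x => rfl))) a b
  have hAd : HasDerivAt (fun b => deriv A b / 2) (deriv (deriv A) b / 2) b :=
    (((contDiff_one_deriv_of_two hA).differentiable one_ne_zero) b).hasDerivAt.div_const 2
  have h : HasDerivAt (fun b => Q a b) (deriv (deriv A) b / 2 +
      (-(c b b * Ψ b b) + ∫ s in b..a, (fderiv ℝ (uncurry c) (s, b) (0, 1) * Ψ s b
        + c s b * Q s b))) b :=
    (hAd.add hL).congr_of_eventuallyEq (Eventually.of_forall fun x => by simp [hQ a x])
  exact h.congr_deriv (by ring)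

/-- The field `P` is continuous. -/
theorem continuous_P (hc : Continuous (uncurry c)) (hA : ContDiff ℝ 2 A)
    (hΨc : Continuous (uncurry Ψ)) (hQc : Continuous (uncurry Q)) :
    Continuous fun p : ℝ × ℝ => deriv A p.1 - Q p.1 p.1 - ∫ s in p.2..p.1, c p.1 s * Ψ p.1 s := by
  refine (((hA.continuous_deriv (by norm_num)).comp continuous_fst).sub
    (hQc.comp ((continuous_fst (X := ℝ) (Y := ℝ)).prodMk continuous_fst))).sub ?_
  have heq : (fun p : ℝ × ℝ => ∫ s in p.2..p.1, c p.1 s * Ψ p.1 s)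
      = fun p : ℝ × ℝ => (∫ s in (0:ℝ)..p.1, c p.1 s * Ψ p.1 s)
          - ∫ s in (0:ℝ)..p.2, c p.1 s * Ψ p.1 s := by
    funext p
    have hx : Continuous fun s => c p.1 s * Ψ p.1 s :=
      (hc.comp (Continuous.prodMk_right p.1)).mul (hΨc.comp (Continuous.prodMk_right p.1))
    rw [integral_interval_sub_left (hx.intervalIntegrable _ _) (hx.intervalIntegrable _ _)]
  rw [heq]
  have hu : Continuous (uncurry fun (p : ℝ × ℝ) s => c p.1 s * Ψ p.1 s) :=
    (hc.comp (continuous_fst.fst.prodMk continuous_snd)).mul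
      (hΨc.comp (continuous_fst.fst.prodMk continuous_snd))
  exact (continuous_parametric_intervalIntegral_of_continuous hu continuous_fst).sub
    (continuous_parametric_intervalIntegral_of_continuous hu continuous_snd)

/-- The field `R = ∂_b Q` is continuous. -/
theorem continuous_R (hc : ContDiff ℝ 1 (uncurry c)) (hA : ContDiff ℝ 2 A)
    (hΨc : Continuous (uncurry Ψ)) (hQc : Continuous (uncurry Q)) :
    Continuous fun p : ℝ × ℝ => deriv (deriv A) p.2 / 2 - c p.2 p.2 * Ψ p.2 p.2 +
      ∫ s in p.2..p.1, (fderiv ℝ (uncurry c) (s, p.2) (0, 1) * Ψ s p.2 + c s p.2 * Q s p.2) := by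
  have hcc : Continuous (uncurry c) := hc.continuous
  have hc₂ : Continuous fun p : ℝ × ℝ => fderiv ℝ (uncurry c) (p.1, p.2) (0, 1) :=
    (hc.continuous_fderiv one_ne_zero).clm_apply continuous_const
  refine (((((contDiff_one_deriv_of_two hA).continuous_deriv (by norm_num)).comp
    continuous_snd).div_const 2).sub
    ((hcc.comp ((continuous_snd (X := ℝ) (Y := ℝ)).prodMk continuous_snd)).mul
      (hΨc.comp ((continuous_snd (X := ℝ) (Y := ℝ)).prodMk continuous_snd)))).add ?_
  set k : ℝ × ℝ → ℝ → ℝ := fun p s =>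
    fderiv ℝ (uncurry c) (s, p.2) (0, 1) * Ψ s p.2 + c s p.2 * Q s p.2 with hk
  have hu : Continuous (uncurry k) :=
    ((hc₂.comp (continuous_snd.prodMk continuous_fst.snd)).mul
      (hΨc.comp (continuous_snd.prodMk continuous_fst.snd))).add
      ((hcc.comp (continuous_snd.prodMk continuous_fst.snd)).mul
        (hQc.comp (continuous_snd.prodMk continuous_fst.snd)))
  have heq : (fun p : ℝ × ℝ => ∫ s in p.2..p.1, k p s)
      = fun p : ℝ × ℝ => (∫ s in (0:ℝ)..p.1, k p s) - ∫ s in (0:ℝ)..p.2, k p s := by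
    funext p
    have hx : Continuous (k p) := hu.comp (Continuous.prodMk_right p)
    rw [integral_interval_sub_left (hx.intervalIntegrable _ _) (hx.intervalIntegrable _ _)]
  show Continuous fun p : ℝ × ℝ => ∫ s in p.2..p.1, k p s
  rw [heq]
  exact (continuous_parametric_intervalIntegral_of_continuous hu continuous_fst).sub
    (continuous_parametric_intervalIntegral_of_continuous hu continuous_snd)

/-- First bootstrap step: `Ψ ∈ C¹`. -/
theorem contDiff_one_psi (hc : Continuous (uncurry c)) (hA : ContDiff ℝ 2 A)
    (hΨc : Continuous (uncurry Ψ)) (hQc : Continuous (uncurry Q))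
    (hΨ : ∀ a b, Ψ a b = A a - ∫ s in b..a, Q a s)
    (hQ : ∀ a b, Q a b = deriv A b / 2 + ∫ s in b..a, c s b * Ψ s b) :
    ContDiff ℝ 1 (uncurry Ψ) := by
  have h := Literature.Analysis.Calculus.contDiffOn_succ_of_partial (f := uncurry Ψ)
    (U := univ) isOpen_univ (n := 0)
    (f₁ := fun p : ℝ × ℝ =>
      (deriv A p.1 - Q p.1 p.1 - ∫ s in p.2..p.1, c p.1 s * Ψ p.1 s) • (1 : ℝ →L[ℝ] ℝ))
    (f₂ := fun p : ℝ × ℝ => (Q p.1 p.2) • (1 : ℝ →L[ℝ] ℝ))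
    (fun p _ => hasFDerivAt_smul_one_of_hasDerivAt (hasDerivAt_psi_fst hc hA hΨc hQc hΨ hQ p.1 p.2))
    (fun p _ => hasFDerivAt_smul_one_of_hasDerivAt (hasDerivAt_psi_snd hQc hΨ p.1 p.2))
    (contDiffOn_zero.2 ((continuous_P hc hA hΨc hQc).smul continuous_const).continuousOn)
    (contDiffOn_zero.2 ((hQc.smul continuous_const).continuousOn))
  simpa using (contDiffOn_univ.1 h)

/-- First bootstrap step: `Q ∈ C¹`. -/
theorem contDiff_one_Q (hc : ContDiff ℝ 1 (uncurry c)) (hA : ContDiff ℝ 2 A)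
    (hΨc : Continuous (uncurry Ψ)) (hQc : Continuous (uncurry Q))
    (hΨ : ∀ a b, Ψ a b = A a - ∫ s in b..a, Q a s)
    (hQ : ∀ a b, Q a b = deriv A b / 2 + ∫ s in b..a, c s b * Ψ s b) :
    ContDiff ℝ 1 (uncurry Q) := by
  have hcc : Continuous (uncurry c) := hc.continuous
  have h := Literature.Analysis.Calculus.contDiffOn_succ_of_partial (f := uncurry Q)
    (U := univ) isOpen_univ (n := 0)
    (f₁ := fun p : ℝ × ℝ => (c p.1 p.2 * Ψ p.1 p.2) • (1 : ℝ →L[ℝ] ℝ))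
    (f₂ := fun p : ℝ × ℝ => (deriv (deriv A) p.2 / 2 - c p.2 p.2 * Ψ p.2 p.2 +
      ∫ s in p.2..p.1, (fderiv ℝ (uncurry c) (s, p.2) (0, 1) * Ψ s p.2 + c s p.2 * Q s p.2))
        • (1 : ℝ →L[ℝ] ℝ))
    (fun p _ => hasFDerivAt_smul_one_of_hasDerivAt (hasDerivAt_Q_fst hcc hΨc hQ p.1 p.2))
    (fun p _ => hasFDerivAt_smul_one_of_hasDerivAt (hasDerivAt_Q_snd hc hA hΨc hQc hΨ hQ p.1 p.2))
    (contDiffOn_zero.2 (((hcc.mul hΨc).smul continuous_const).continuousOn))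
    (contDiffOn_zero.2 ((continuous_R hc hA hΨc hQc).smul continuous_const).continuousOn)
  simpa using (contDiffOn_univ.1 h)

/-- Second bootstrap step: the Volterra term `Φ₁(a,b) = ∫_b^a c(a,s)Ψ(a,s) ds` of `P` is `C¹`
(Leibniz rule with `∂_a(cΨ) = (∂_a c)Ψ + cP`, and `∂_b Φ₁ = −c(a,b)Ψ(a,b)`). -/
theorem contDiff_one_volterra (hc : ContDiff ℝ 1 (uncurry c)) (hA : ContDiff ℝ 2 A)
    (hΨc : Continuous (uncurry Ψ)) (hQc : Continuous (uncurry Q))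
    (hΨ : ∀ a b, Ψ a b = A a - ∫ s in b..a, Q a s)
    (hQ : ∀ a b, Q a b = deriv A b / 2 + ∫ s in b..a, c s b * Ψ s b) :
    ContDiff ℝ 1 (fun p : ℝ × ℝ => ∫ s in p.2..p.1, c p.1 s * Ψ p.1 s) := by
  have hcc : Continuous (uncurry c) := hc.continuous
  have hc₁ : Continuous fun p : ℝ × ℝ => fderiv ℝ (uncurry c) (p.1, p.2) (1, 0) :=
    (hc.continuous_fderiv one_ne_zero).clm_apply continuous_const
  have hPc := continuous_P hcc hA hΨc hQc
  -- the `C⁰` field `∂_a(cΨ) = (∂_a c) Ψ + c P`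
  set k₁ : ℝ → ℝ → ℝ := fun a s => fderiv ℝ (uncurry c) (a, s) (1, 0) * Ψ a s +
    c a s * (deriv A a - Q a a - ∫ u in s..a, c a u * Ψ a u) with hk₁
  have hk₁c : Continuous (uncurry k₁) :=
    (hc₁.mul hΨc).add (hcc.mul (hPc.comp (continuous_fst.prodMk continuous_snd)))
  have hder : ∀ a s, HasDerivAt (fun a => c a s * Ψ a s) (k₁ a s) a := fun a s =>
    (hasDerivAt_c_fst hc a s).mul (hasDerivAt_psi_fst hcc hA hΨc hQc hΨ hQ a s)
  -- partial derivatives of `Φ₁`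
  have h₁ : ∀ p : ℝ × ℝ, HasDerivAt (fun a => ∫ s in p.2..a, c a s * Ψ a s)
      (c p.1 p.1 * Ψ p.1 p.1 + ∫ s in p.2..p.1, k₁ p.1 s) p.1 := fun p =>
    hasDerivAt_integral_param_upper (k := fun a s => c a s * Ψ a s) (hcc.mul hΨc) hk₁c hder
      p.2 p.1
  have h₂ : ∀ p : ℝ × ℝ, HasDerivAt (fun b => ∫ s in b..p.1, c p.1 s * Ψ p.1 s)
      (-(c p.1 p.2 * Ψ p.1 p.2)) p.2 := by
    intro p
    have hx : Continuous fun s => c p.1 s * Ψ p.1 s :=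
      (hcc.comp (Continuous.prodMk_right p.1)).mul (hΨc.comp (Continuous.prodMk_right p.1))
    exact integral_hasDerivAt_left (hx.intervalIntegrable _ _)
      (hx.stronglyMeasurableAtFilter _ _) hx.continuousAt
  -- continuity of the two partial-derivative fields
  have hf₁ : Continuous fun p : ℝ × ℝ => c p.1 p.1 * Ψ p.1 p.1 + ∫ s in p.2..p.1, k₁ p.1 s := by
    refine ((hcc.comp (continuous_fst.prodMk continuous_fst)).mul
      (hΨc.comp (continuous_fst.prodMk continuous_fst))).add ?_
    have hu : Continuous (uncurry fun (p : ℝ × ℝ) s => k₁ p.1 s) :=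
      hk₁c.comp (continuous_fst.fst.prodMk continuous_snd)
    have heq : (fun p : ℝ × ℝ => ∫ s in p.2..p.1, k₁ p.1 s)
        = fun p : ℝ × ℝ => (∫ s in (0:ℝ)..p.1, k₁ p.1 s) - ∫ s in (0:ℝ)..p.2, k₁ p.1 s := by
      funext p
      have hx : Continuous (k₁ p.1) := hk₁c.comp (Continuous.prodMk_right p.1)
      rw [integral_interval_sub_left (hx.intervalIntegrable _ _) (hx.intervalIntegrable _ _)]
    rw [heq]
    exact (continuous_parametric_intervalIntegral_of_continuous hu continuous_fst).sub
      (continuous_parametric_intervalIntegral_of_continuous hu continuous_snd)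
  have hf₂ : Continuous fun p : ℝ × ℝ => -(c p.1 p.2 * Ψ p.1 p.2) := (hcc.mul hΨc).neg
  have h := Literature.Analysis.Calculus.contDiffOn_succ_of_partial
    (f := fun p : ℝ × ℝ => ∫ s in p.2..p.1, c p.1 s * Ψ p.1 s) (U := univ) isOpen_univ (n := 0)
    (f₁ := fun p : ℝ × ℝ => (c p.1 p.1 * Ψ p.1 p.1 + ∫ s in p.2..p.1, k₁ p.1 s) •
      (1 : ℝ →L[ℝ] ℝ))
    (f₂ := fun p : ℝ × ℝ => (-(c p.1 p.2 * Ψ p.1 p.2)) • (1 : ℝ →L[ℝ] ℝ))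
    (fun p _ => hasFDerivAt_smul_one_of_hasDerivAt (h₁ p)) (fun p _ => hasFDerivAt_smul_one_of_hasDerivAt (h₂ p))
    (contDiffOn_zero.2 (hf₁.smul continuous_const).continuousOn)
    (contDiffOn_zero.2 (hf₂.smul continuous_const).continuousOn)
  simpa using (contDiffOn_univ.1 h)

/-- Second bootstrap step: `P ∈ C¹`. -/
theorem contDiff_one_P (hc : ContDiff ℝ 1 (uncurry c)) (hA : ContDiff ℝ 2 A)
    (hΨc : Continuous (uncurry Ψ)) (hQc : Continuous (uncurry Q))
    (hΨ : ∀ a b, Ψ a b = A a - ∫ s in b..a, Q a s)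
    (hQ : ∀ a b, Q a b = deriv A b / 2 + ∫ s in b..a, c s b * Ψ s b) :
    ContDiff ℝ 1 (fun p : ℝ × ℝ =>
      deriv A p.1 - Q p.1 p.1 - ∫ s in p.2..p.1, c p.1 s * Ψ p.1 s) := by
  have hQ1 := contDiff_one_Q hc hA hΨc hQc hΨ hQ
  refine (((contDiff_one_deriv_of_two hA).comp contDiff_fst).sub ?_).sub
    (contDiff_one_volterra hc hA hΨc hQc hΨ hQ)
  exact hQ1.comp (contDiff_fst.prodMk contDiff_fst)

/-- **The solution of the characteristic integral equations is `C²`.** -/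
theorem contDiff_two_psi (hc : ContDiff ℝ 1 (uncurry c)) (hA : ContDiff ℝ 2 A)
    (hΨc : Continuous (uncurry Ψ)) (hQc : Continuous (uncurry Q))
    (hΨ : ∀ a b, Ψ a b = A a - ∫ s in b..a, Q a s)
    (hQ : ∀ a b, Q a b = deriv A b / 2 + ∫ s in b..a, c s b * Ψ s b) :
    ContDiff ℝ 2 (uncurry Ψ) := by
  have hcc : Continuous (uncurry c) := hc.continuous
  have h := Literature.Analysis.Calculus.contDiffOn_succ_of_partial (f := uncurry Ψ)
    (U := univ) isOpen_univ (n := 1)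
    (f₁ := fun p : ℝ × ℝ =>
      (deriv A p.1 - Q p.1 p.1 - ∫ s in p.2..p.1, c p.1 s * Ψ p.1 s) • (1 : ℝ →L[ℝ] ℝ))
    (f₂ := fun p : ℝ × ℝ => (Q p.1 p.2) • (1 : ℝ →L[ℝ] ℝ))
    (fun p _ => hasFDerivAt_smul_one_of_hasDerivAt (hasDerivAt_psi_fst hcc hA hΨc hQc hΨ hQ p.1 p.2))
    (fun p _ => hasFDerivAt_smul_one_of_hasDerivAt (hasDerivAt_psi_snd hQc hΨ p.1 p.2))
    (((contDiff_one_P hc hA hΨc hQc hΨ hQ).smul contDiff_const).contDiffOn)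
    (((contDiff_one_Q hc hA hΨc hQc hΨ hQ).smul contDiff_const).contDiffOn)
  have h2 : ContDiffOn ℝ 2 (uncurry Ψ) univ := by simpa [one_add_one_eq_two] using h
  exact contDiffOn_univ.1 h2

/-- The total derivative of `Ψ`: `DΨ = P da + Q db`. -/
theorem hasFDerivAt_psi (hc : ContDiff ℝ 1 (uncurry c)) (hA : ContDiff ℝ 2 A)
    (hΨc : Continuous (uncurry Ψ)) (hQc : Continuous (uncurry Q))
    (hΨ : ∀ a b, Ψ a b = A a - ∫ s in b..a, Q a s)
    (hQ : ∀ a b, Q a b = deriv A b / 2 + ∫ s in b..a, c s b * Ψ s b) (p : ℝ × ℝ) :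
    HasFDerivAt (uncurry Ψ)
      ((deriv A p.1 - Q p.1 p.1 - ∫ s in p.2..p.1, c p.1 s * Ψ p.1 s) •
          ContinuousLinearMap.fst ℝ ℝ ℝ + (Q p.1 p.2) • ContinuousLinearMap.snd ℝ ℝ ℝ) p := by
  have hcc : Continuous (uncurry c) := hc.continuous
  have h := Literature.Analysis.Calculus.hasFDerivAt_of_partial_of_isOpen (f := uncurry Ψ)
    (U := univ) isOpen_univ
    (f₁ := fun p : ℝ × ℝ =>
      (deriv A p.1 - Q p.1 p.1 - ∫ s in p.2..p.1, c p.1 s * Ψ p.1 s) • (1 : ℝ →L[ℝ] ℝ))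
    (f₂ := fun p : ℝ × ℝ => (Q p.1 p.2) • (1 : ℝ →L[ℝ] ℝ))
    (fun p _ => hasFDerivAt_smul_one_of_hasDerivAt (hasDerivAt_psi_fst hcc hA hΨc hQc hΨ hQ p.1 p.2))
    (fun p _ => hasFDerivAt_smul_one_of_hasDerivAt (hasDerivAt_psi_snd hQc hΨ p.1 p.2))
    ((continuous_P hcc hA hΨc hQc).smul continuous_const).continuousOn (mem_univ p)
  refine h.congr_fderiv ?_
  ext <;> simp

/-- `∂_b P = c Ψ`, as a value of the total derivative of `P`. -/
theorem fderiv_P_snd (hc : ContDiff ℝ 1 (uncurry c)) (hA : ContDiff ℝ 2 A)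
    (hΨc : Continuous (uncurry Ψ)) (hQc : Continuous (uncurry Q))
    (hΨ : ∀ a b, Ψ a b = A a - ∫ s in b..a, Q a s)
    (hQ : ∀ a b, Q a b = deriv A b / 2 + ∫ s in b..a, c s b * Ψ s b) (p : ℝ × ℝ) :
    fderiv ℝ (fun p : ℝ × ℝ => deriv A p.1 - Q p.1 p.1 - ∫ s in p.2..p.1, c p.1 s * Ψ p.1 s)
      p (0, 1) = c p.1 p.2 * Ψ p.1 p.2 := by
  have hcc : Continuous (uncurry c) := hc.continuous
  have hd := ((contDiff_one_P hc hA hΨc hQc hΨ hQ).differentiable one_ne_zero p).hasFDerivAt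
  have h1 := hasDerivAt_snd_of_hasFDerivAt hd
  -- the `b`-line of `P` by the fundamental theorem of calculus
  have hx : Continuous fun s => c p.1 s * Ψ p.1 s :=
    (hcc.comp (Continuous.prodMk_right p.1)).mul (hΨc.comp (Continuous.prodMk_right p.1))
  have h2 : HasDerivAt (fun b => deriv A p.1 - Q p.1 p.1 - ∫ s in b..p.1, c p.1 s * Ψ p.1 s)
      (c p.1 p.2 * Ψ p.1 p.2) p.2 := by
    have h0 : HasDerivAt (fun u => ∫ s in u..p.1, c p.1 s * Ψ p.1 s) (-(c p.1 p.2 * Ψ p.1 p.2))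
        p.2 :=
      integral_hasDerivAt_left (hx.intervalIntegrable p.2 p.1)
        (hx.stronglyMeasurableAtFilter _ _) hx.continuousAt
    exact ((h0.const_sub (deriv A p.1 - Q p.1 p.1)).congr_of_eventuallyEq
      (Eventually.of_forall fun x => rfl)).congr_deriv (neg_neg _)
  exact h1.unique h2

/-- `∂_a Q = c Ψ`, as a value of the total derivative of `Q`. -/
theorem fderiv_Q_fst (hc : ContDiff ℝ 1 (uncurry c)) (hA : ContDiff ℝ 2 A)
    (hΨc : Continuous (uncurry Ψ)) (hQc : Continuous (uncurry Q))
    (hΨ : ∀ a b, Ψ a b = A a - ∫ s in b..a, Q a s)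
    (hQ : ∀ a b, Q a b = deriv A b / 2 + ∫ s in b..a, c s b * Ψ s b) (p : ℝ × ℝ) :
    fderiv ℝ (uncurry Q) p (1, 0) = c p.1 p.2 * Ψ p.1 p.2 := by
  have hd := ((contDiff_one_Q hc hA hΨc hQc hΨ hQ).differentiable one_ne_zero p).hasFDerivAt
  have h1 := hasDerivAt_fst_of_hasFDerivAt hd
  exact h1.unique (hasDerivAt_Q_fst hc.continuous hΨc hQ p.1 p.2)

end Bootstrap

end Summit.FinalStateConjecture.FinalStateConjecture.Theorems.Blindness

end
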